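import Literature.Barriers.CriticalPhenomena.KozmaNachmiasOneArm
import Literature.Probability.Percolation.HutchcroftVolumeTail
import HarnessLib

/-!
# Kozma–Nachmias 2011, Lemma 2.3, the term `B₂`: the regeneration bound

Barrier catalogue `Literature/Barriers/CriticalPhenomena/` (D-0021), companion of
`KozmaNachmiasOneArm.lean` (decomposition of the named fact `KozmaNachmias2011_oneArmUpper`). This
file PROVES, in a generic form, the estimate of the term `B₂` in the proof of Kozma–Nachmias 2011,
Lemma 2.3 (pp. 382–383): "We estimate `P(B₂)` using a regeneration argument … Let `j₀` be the first
`j` for which `0 < X_j ≤ L²`, and condition on `𝒞 = C(0; Q_{j₀})` … If `0 ↔ ∂Q_{r(1+λ)}`, then one of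
the vertices of `∂𝒞` must be connected to `∂Q_{r(1+λ)}` off `𝒞` … the conditioning over
`C(0; Q_{j₀}) = A` gives no information on the rest of the configuration … The sum over all `x`
gives a factor of at most `L²` by definition of `j₀`. … `P(B₂) ≤ L² γ(λr/2) γ(r)`."

The formalisation reuses the exploration machinery of Duminil-Copin–Tassion 2016, §2.1
(`SharpnessDCTProofs.lean`: `clusterEvent S C = {C(0;S) = C}` determined by `clusterPairs S C`,
the decomposition `exists_decomposition` of `{0 ↔ ∂Λ_N}` along the last visit to `C(0;S)`, the
independence `real_inter_three`, and `exitEvent ⊆ armEvent`), with `S = Q_j` and an extra event `H`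
(think `H_j = {j = j₀}`) which, on `{C(0;Q_j) = C}`, is determined by the edges of the cluster and
forces `|C ∩ ∂Q_j| ≤ T`:

* `real_inter_three_of_determinedBy` — independence of `A ∩ {xy open} ∩ {y ↔ ∂Λ_N in Λ_N ∖ C}`
  for any `A` determined by `clusterPairs S C`;
* `real_siteToBoundary_inter_le_sum` — the union bound/decomposition of `{0 ↔ ∂Λ_N} ∩ H`;
* `real_siteToBoundary_inter_le_of_box` — **one box**: for `S = Q_j`, `N = m + j + 1`,
  `P(0 ↔ ∂Q_N, H) ≤ 2d · T · P(0 ↔ ∂Q_m) · P(H, 0 ↔ ∂Q_j)` (the factor `2d ≥ |{y ∼ x, y ∉ Q_j}|`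
  comes from decomposing along the first edge leaving `C`, as in Duminil-Copin–Tassion, instead of the
  first vertex as in the source; it is absorbed into `T` by the user);
* `regeneration_bound` — **summed over the candidate boxes** `j ∈ J` with pairwise disjoint `H_j`
  (`j₀` is unique): `P(0 ↔ ∂Q_N, ⋃_{j∈J} H_j) ≤ 2d · T · P(0 ↔ ∂Q_{m₀}) · P(0 ↔ ∂Q_{j₁})` whenever
  `j₁ ≤ j` and `j + 1 + m₀ ≤ N` on `J` — the printed `P(B₂) ≤ L² γ(λr/2) γ(r)`.

## References

* G. Kozma, A. Nachmias, J. Amer. Math. Soc. 24 (2011) 375–409: proof of Lemma 2.3, the term `B₂`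
  and (2.2), pp. 382–383; §1.6 (`C(x; A)`, "`x ↔ y` off `A`").
* H. Duminil-Copin, V. Tassion, Enseign. Math. 62 (2016) 199–206, §2.1 (the exploration argument).
-/

noncomputable section

namespace Literature.Barriers.CriticalPhenomena

open _root_.MeasureTheory Finset Literature.Probability.LatticeModels Literature.Probability.Percolation
  Literature.Probability.Percolation.DCT16
open scoped Literature.Probability.LatticeModels Literature.Probability.Percolation

variable {d : ℕ}

/-! ### Preliminaries -/

section Prelim

/-- **First exit** (set version of `real_siteToBoundary_antitone`): for `ω ⊆ E(ℤ^d)` and `m ≤ n`,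
`0 ↔ ∂Λ_n` implies `0 ↔ ∂Λ_m`. [cite: DuminilCopinTassionEM2016, §2.1] -/
theorem mem_siteToBoundary_of_le {ω : BondConfig (Site d)} (hω : ω ⊆ (zdGraph d).edgeSet)
    {m n : ℕ} (hmn : m ≤ n) (h : ω ∈ siteToBoundary d n) : ω ∈ siteToBoundary d m := by
  rw [← armEvent_zero] at h ⊢
  obtain ⟨y, hy, hpath⟩ := h
  rw [sub_zero] at hy
  refine armEvent_of_pathIn hω (pathIn_of_mem_openConnIn hpath) ?_
  rcases hmn.lt_or_eq with hlt | rfl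
  · exact Or.inl (by rw [sub_zero]; exact notMem_box_of_mem_innerBoundary_box hlt hy)
  · exact Or.inr (by rw [sub_zero]; exact hy)

/-- A site of `Λ_j` with a neighbour outside `Λ_j` lies on the sphere `∂Λ_j` (`d ≥ 1`). [folklore] -/
theorem mem_sphere_of_adj_not_mem_box (hd : 1 ≤ d) {j : ℕ} {x y : Site d} (hx : x ∈ box d j)
    (hy : y ∉ box d j) (hxy : (zdGraph d).Adj x y) : x ∈ sphere d j := by
  rw [sphere_eq_innerBoundary hd, mem_innerBoundary_iff]
  exact ⟨hx, y, hy, hxy⟩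

/-- On `{C(0; Λ_j) = C}` with `C` meeting the sphere `∂Λ_j`, `0 ↔ ∂Λ_j` (`d ≥ 1`). [folklore] -/
theorem mem_siteToBoundary_of_clusterEvent (hd : 1 ≤ d) {j : ℕ} {C : Finset (Site d)}
    {ω : BondConfig (Site d)} (hω : ω ∈ clusterEvent (box d j) C) {x : Site d} (hx : x ∈ sphere d j)
    (hxC : x ∈ C) : ω ∈ siteToBoundary d j := by
  refine ⟨x, by rw [← sphere_eq_innerBoundary hd]; exact hx, ?_⟩
  have : x ∈ clusterSet (box d j) ω := by
    rw [show clusterSet (box d j) ω = ↑C from hω]; exact hxC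
  exact this

end Prelim

/-! ### Independence and decomposition with an extra cluster-measurable event -/

section Decomposition

variable (p : unitInterval)

/-- **Independence of the three events**, for any event `A` determined by the pairs of `S` touching
`C` in place of `{C(0;S) = C}` (Duminil-Copin–Tassion 2016, §2.1; Kozma–Nachmias 2011, p. 383:
"the conditioning over `C(0; Q_{j₀}) = A` gives no information on the rest of the configuration"):
for `x ∈ C ⊆ S ∌ y`, `x ∼ y`, `P_p[A ∩ {xy open} ∩ {y ↔ ∂Λ_N in Λ_N ∖ C}] = P_p[A] · p ·
P_p[y ↔ ∂Λ_N in Λ_N ∖ C]`. [cite: KozmaNachmias2011, proof of Lemma 2.3 (term B₂, p. 383)] -/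
theorem real_inter_three_of_determinedBy {S C : Finset (Site d)} {A : Set (BondConfig (Site d))}
    (hA : DeterminedBy A ↑(clusterPairs S C)) {x y : Site d} (hxC : x ∈ C) (hyS : y ∉ S)
    (hxy : (zdGraph d).Adj x y) (N : ℕ) :
    (bondPercolation (zdGraph d) p).real (A ∩ {ω | s(x, y) ∈ ω} ∩ exitEvent N C y) =
      (bondPercolation (zdGraph d) p).real A * p *
        (bondPercolation (zdGraph d) p).real (exitEvent N C y) := by
  classical
  have hE : s(x, y) ∈ (zdGraph d).edgeSet := hxy
  have hB : DeterminedBy {ω : BondConfig (Site d) | s(x, y) ∈ ω} ↑({s(x, y)} : Finset _) := by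
    rw [Finset.coe_singleton]; exact determinedBy_mem _
  have hAB : DeterminedBy (A ∩ {ω | s(x, y) ∈ ω}) ↑(clusterPairs S C ∪ {s(x, y)}) := by
    rw [Finset.coe_union]
    exact (hA.mono Set.subset_union_left).inter (hB.mono Set.subset_union_right)
  have hD : DeterminedBy (exitEvent N C y) ↑((box d N \ C).sym2) := determinedBy_exitEvent N C y
  have hdisj1 : Disjoint (clusterPairs S C) {s(x, y)} := by
    rw [Finset.disjoint_singleton_right]
    intro h
    simp only [clusterPairs, Finset.mem_sdiff, Finset.mk_mem_sym2_iff] at h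
    exact hyS h.1.2
  have hdisj2 : Disjoint (clusterPairs S C ∪ {s(x, y)}) ((box d N \ C).sym2) := by
    rw [Finset.disjoint_left]
    rintro e he he'
    rcases Finset.mem_union.1 he with he | he
    · induction e using Sym2.ind with
      | h a b =>
        obtain ⟨he1, he2⟩ := Finset.mem_sdiff.1 he
        rw [Finset.mk_mem_sym2_iff] at he1 he2
        obtain ⟨ha', hb'⟩ := Finset.mk_mem_sym2_iff.1 he'
        rw [Finset.mem_sdiff] at ha' hb'
        exact he2 ⟨Finset.mem_sdiff.2 ⟨he1.1, ha'.2⟩, Finset.mem_sdiff.2 ⟨he1.2, hb'.2⟩⟩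
    · rw [Finset.mem_singleton] at he
      subst he
      simp only [Finset.mk_mem_sym2_iff, Finset.mem_sdiff] at he'
      exact he'.1.2 hxC
  rw [real_inter_of_determinedBy_disjoint (zdGraph d) p hAB hD hdisj2,
    real_inter_of_determinedBy_disjoint (zdGraph d) p hA hB hdisj1,
    bondPercolation_cylinder (zdGraph d) p hE]

/-- **Union bound over the decomposition, with an extra event `H`** (Duminil-Copin–Tassion 2016,
§2.1; Kozma–Nachmias 2011, (2.2)): for `0 ∈ S ⊆ Λ_L`, `L < N`,
`P_p[{0 ↔ ∂Λ_N} ∩ H] ≤ Σ_{x ∈ S} Σ_{y ∼ x, y ∉ S} Σ_{x ∈ C ⊆ S}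
P_p[({C(0;S) = C} ∩ H) ∩ {xy open} ∩ {y ↔ ∂Λ_N in Λ_N ∖ C}]`.
[cite: KozmaNachmias2011, proof of Lemma 2.3 ((2.2), p. 382)] -/
theorem real_siteToBoundary_inter_le_sum {S : Finset (Site d)} (h0 : (0 : Site d) ∈ S)
    {L N : ℕ} (hSL : S ⊆ box d L) (hLN : L < N) (H : Set (BondConfig (Site d))) :
    (bondPercolation (zdGraph d) p).real (siteToBoundary d N ∩ H) ≤
      ∑ x ∈ S, ∑ y ∈ (zdGraph d).neighborFinset x with y ∉ S, ∑ C ∈ S.powerset with x ∈ C,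
        (bondPercolation (zdGraph d) p).real
          ((clusterEvent S C ∩ H) ∩ {ω | s(x, y) ∈ ω} ∩ exitEvent N C y) := by
  set μ := bondPercolation (zdGraph d) p with hμ
  calc μ.real (siteToBoundary d N ∩ H)
      ≤ μ.real (⋃ x ∈ S, ⋃ y ∈ ((zdGraph d).neighborFinset x).filter (· ∉ S),
          ⋃ C ∈ S.powerset.filter (x ∈ ·),
            ((clusterEvent S C ∩ H) ∩ {ω | s(x, y) ∈ ω} ∩ exitEvent N C y)) := by
        refine real_mono_of_forall_subset_edgeSet (zdGraph d) p fun ω hω hωN => ?_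
        obtain ⟨x, hx, y, hy, hyS, C, hC, hxC, h1, h2, h3⟩ :=
          exists_decomposition h0 hSL hLN hω hωN.1
        simp only [Set.mem_iUnion, Finset.mem_filter, exists_prop]
        exact ⟨x, hx, y, ⟨hy, hyS⟩, C, ⟨hC, hxC⟩, ⟨⟨h1, hωN.2⟩, h2⟩, h3⟩
    _ ≤ ∑ x ∈ S, μ.real (⋃ y ∈ ((zdGraph d).neighborFinset x).filter (· ∉ S),
          ⋃ C ∈ S.powerset.filter (x ∈ ·),
            ((clusterEvent S C ∩ H) ∩ {ω | s(x, y) ∈ ω} ∩ exitEvent N C y)) :=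
        measureReal_biUnion_finset_le _ _
    _ ≤ ∑ x ∈ S, ∑ y ∈ (zdGraph d).neighborFinset x with y ∉ S, μ.real
          (⋃ C ∈ S.powerset.filter (x ∈ ·),
            ((clusterEvent S C ∩ H) ∩ {ω | s(x, y) ∈ ω} ∩ exitEvent N C y)) :=
        Finset.sum_le_sum fun x _ => measureReal_biUnion_finset_le _ _
    _ ≤ _ := Finset.sum_le_sum fun x _ => Finset.sum_le_sum fun y _ =>
        measureReal_biUnion_finset_le _ _

end Decomposition

/-! ### One box: `P(0 ↔ ∂Q_{m+j+1}, H) ≤ 2d·T·P(0 ↔ ∂Q_m)·P(H, 0 ↔ ∂Q_j)` -/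

section OneBox

variable (p : unitInterval)

/-- **Resummation over the values of `C(0;Q_j)`** (Kozma–Nachmias 2011, p. 383: "The sum over all
`x` gives a factor of at most `L²` by definition of `j₀`. Plugging this into (2.2) gives
`P(B₂) ≤ L² γ(λr/2) Σ_A P(𝒞 = A)`"): if on each `{C(0;Q_j) = C}` the event `H` is determined by the
edges of `Q_j` touching `C` and forces `|C ∩ ∂Q_j| ≤ T`, then
`Σ_{x ∈ ∂Q_j} Σ_{x ∈ C ⊆ Q_j} P({C(0;Q_j) = C} ∩ H) = Σ_C |C ∩ ∂Q_j| P({C(0;Q_j)=C} ∩ H)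
≤ T · P(H ∩ {0 ↔ ∂Q_j})` (the events `{C(0;Q_j) = C}` are pairwise disjoint, and those with
`C ∩ ∂Q_j ≠ ∅` lie in `{0 ↔ ∂Q_j}`). [cite: KozmaNachmias2011, proof of Lemma 2.3 (term B₂, p. 383)] -/
theorem sum_sphere_sum_real_clusterEvent_inter_le (hd : 1 ≤ d) (j : ℕ)
    {H : Set (BondConfig (Site d))} {T : ℝ} (hT0 : 0 ≤ T)
    (hdet : ∀ C ∈ (box d j).powerset,
      DeterminedBy (clusterEvent (box d j) C ∩ H) ↑(clusterPairs (box d j) C))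
    (hT : ∀ C ∈ (box d j).powerset, (clusterEvent (box d j) C ∩ H).Nonempty →
      (#((sphere d j).filter (· ∈ C)) : ℝ) ≤ T) :
    ∑ x ∈ sphere d j, ∑ C ∈ (box d j).powerset with x ∈ C,
        (bondPercolation (zdGraph d) p).real (clusterEvent (box d j) C ∩ H) ≤
      T * (bondPercolation (zdGraph d) p).real (H ∩ siteToBoundary d j) := by
  classical
  have ha0 : ∀ C, 0 ≤ (bondPercolation (zdGraph d) p).real (clusterEvent (box d j) C ∩ H) :=
    fun C => measureReal_nonneg
  -- exchange the sums: `Σ_{x ∈ ∂Λ_j} Σ_{C ∋ x} a C = Σ_C |∂Λ_j ∩ C| a C`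
  have h4 : ∑ x ∈ sphere d j, ∑ C ∈ (box d j).powerset with x ∈ C,
      (bondPercolation (zdGraph d) p).real (clusterEvent (box d j) C ∩ H) =
        ∑ C ∈ (box d j).powerset, (#((sphere d j).filter (· ∈ C)) : ℝ) *
          (bondPercolation (zdGraph d) p).real (clusterEvent (box d j) C ∩ H) := by
    simp only [Finset.sum_filter]
    rw [Finset.sum_comm]
    refine Finset.sum_congr rfl fun C _ => ?_
    rw [← Finset.sum_filter, Finset.sum_const, nsmul_eq_mul]
  -- `|∂Λ_j ∩ C| a C ≤ T a C`, and only the `C` meeting `∂Λ_j` contribute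
  have h5 : ∑ C ∈ (box d j).powerset, (#((sphere d j).filter (· ∈ C)) : ℝ) *
      (bondPercolation (zdGraph d) p).real (clusterEvent (box d j) C ∩ H) ≤
        T * ∑ C ∈ (box d j).powerset with ((sphere d j).filter (· ∈ C)).Nonempty,
          (bondPercolation (zdGraph d) p).real (clusterEvent (box d j) C ∩ H) := by
    have hvanish : ∀ C ∈ (box d j).powerset,
        C ∉ (box d j).powerset.filter (fun C => ((sphere d j).filter (· ∈ C)).Nonempty) →
          (#((sphere d j).filter (· ∈ C)) : ℝ) *
            (bondPercolation (zdGraph d) p).real (clusterEvent (box d j) C ∩ H) = 0 := by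
      intro C hC hCQ
      have : (sphere d j).filter (· ∈ C) = ∅ := by
        rw [← Finset.not_nonempty_iff_eq_empty]
        exact fun hne => hCQ (Finset.mem_filter.2 ⟨hC, hne⟩)
      rw [this, Finset.card_empty, Nat.cast_zero, zero_mul]
    rw [← Finset.sum_subset (Finset.filter_subset _ (box d j).powerset) hvanish, Finset.mul_sum]
    refine Finset.sum_le_sum fun C hC => ?_
    obtain ⟨hCP, -⟩ := Finset.mem_filter.1 hC
    rcases eq_or_lt_of_le (ha0 C) with h0 | hpos
    · rw [← h0, mul_zero, mul_zero]
    · refine mul_le_mul_of_nonneg_right (hT C hCP ?_) (ha0 C)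
      refine nonempty_of_measure_ne_zero (μ := bondPercolation (zdGraph d) p) fun hzero => hpos.ne' ?_
      rw [measureReal_def, hzero, ENNReal.toReal_zero]
  -- `Σ_{C meeting ∂Λ_j} a C = P(⋃ …) ≤ P(H ∩ {0 ↔ ∂Λ_j})`
  have h6 : ∑ C ∈ (box d j).powerset with ((sphere d j).filter (· ∈ C)).Nonempty,
      (bondPercolation (zdGraph d) p).real (clusterEvent (box d j) C ∩ H) ≤
        (bondPercolation (zdGraph d) p).real (H ∩ siteToBoundary d j) := by
    rw [← measureReal_biUnion_finset]
    · refine measureReal_mono fun ω hω => ?_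
      simp only [Set.mem_iUnion, exists_prop] at hω
      obtain ⟨C, hCQ, hωC, hωH⟩ := hω
      obtain ⟨-, ⟨x, hx⟩⟩ := Finset.mem_filter.1 hCQ
      obtain ⟨hxs, hxC⟩ := Finset.mem_filter.1 hx
      exact ⟨hωH, mem_siteToBoundary_of_clusterEvent hd hωC hxs hxC⟩
    · intro C _ C' _ hCC'
      refine Set.disjoint_left.2 fun ω h h' => hCC' ?_
      exact Finset.coe_injective (h.1.symm.trans h'.1)
    · intro C hC
      exact (hdet C (Finset.mem_filter.1 hC).1).measurableSet_of_finset
  rw [h4]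
  exact h5.trans (mul_le_mul_of_nonneg_left h6 hT0)

/-- Each term of the decomposition is at most `P({C(0;Q_j)=C} ∩ H) · P(0 ↔ ∂Q_m)` when
`N = m + j + 1`: independence, `p ≤ 1`, and `{y ↔ ∂Q_N off C} ⊆ {y ↔ y + ∂Q_m}` for `y ∈ Q_{j+1}`
(translation invariance). [cite: KozmaNachmias2011, proof of Lemma 2.3 (term B₂, p. 383)] -/
theorem real_term_le {j m : ℕ} {H : Set (BondConfig (Site d))} {C : Finset (Site d)}
    (hdet : DeterminedBy (clusterEvent (box d j) C ∩ H) ↑(clusterPairs (box d j) C))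
    {x y : Site d} (hx : x ∈ box d j) (hxC : x ∈ C) (hy : y ∉ box d j) (hxy : (zdGraph d).Adj x y) :
    (bondPercolation (zdGraph d) p).real
        ((clusterEvent (box d j) C ∩ H) ∩ {ω | s(x, y) ∈ ω} ∩ exitEvent (m + j + 1) C y) ≤
      (bondPercolation (zdGraph d) p).real (clusterEvent (box d j) C ∩ H) *
        (bondPercolation (zdGraph d) p).real (siteToBoundary d m) := by
  rw [real_inter_three_of_determinedBy p hdet hxC hy hxy (m + j + 1), mul_assoc]
  refine mul_le_mul_of_nonneg_left ?_ measureReal_nonneg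
  calc (p : ℝ) * (bondPercolation (zdGraph d) p).real (exitEvent (m + j + 1) C y)
      ≤ 1 * (bondPercolation (zdGraph d) p).real (exitEvent (m + j + 1) C y) :=
        mul_le_mul_of_nonneg_right (unitInterval.le_one p) measureReal_nonneg
    _ ≤ (bondPercolation (zdGraph d) p).real (siteToBoundary d m) := by
        rw [one_mul, ← real_armEvent p y m]
        have hyL : y ∈ box d (j + 1) :=
          Literature.Probability.Percolation.DCT16.mem_box_succ_of_adj hx hxy
        refine real_mono_of_forall_subset_edgeSet (zdGraph d) p fun ω hω h => ?_
        exact armEvent_of_mem_exitEvent hyL hω h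

/-- **The regeneration bound for one box** (Kozma–Nachmias 2011, proof of Lemma 2.3, term `B₂`, at a
fixed value `j` of `j₀`): let `H` be an event which, on each `{C(0;Q_j) = C}`, is determined by the
edges of `Q_j` touching `C` and forces `|C ∩ ∂Q_j| ≤ T` (in the source: `H = {j₀ = j}`, where `j₀` is
the first index with `X_{j₀} ≤ L²`, `T = L²`). Then for `N = m + j + 1`,
`P(0 ↔ ∂Q_N, H) ≤ 2d · T · P(0 ↔ ∂Q_m) · P(H ∩ {0 ↔ ∂Q_j})`: decompose along the last visit `x` to
`C(0;Q_j)` and the next (open) edge `xy`, `y ∉ Q_j` (at most `2d` choices, and none unless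
`x ∈ ∂Q_j`), bound each term by `real_term_le`, and resum over `C`
(`sum_sphere_sum_real_clusterEvent_inter_le`).
[cite: KozmaNachmias2011, proof of Lemma 2.3 (term B₂, pp. 382–383)] -/
theorem real_siteToBoundary_inter_le_of_box (hd : 1 ≤ d) (j m : ℕ) {H : Set (BondConfig (Site d))}
    {T : ℝ} (hT0 : 0 ≤ T)
    (hdet : ∀ C ∈ (box d j).powerset,
      DeterminedBy (clusterEvent (box d j) C ∩ H) ↑(clusterPairs (box d j) C))
    (hT : ∀ C ∈ (box d j).powerset, (clusterEvent (box d j) C ∩ H).Nonempty →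
      (#((sphere d j).filter (· ∈ C)) : ℝ) ≤ T) :
    (bondPercolation (zdGraph d) p).real (siteToBoundary d (m + j + 1) ∩ H) ≤
      2 * d * T * (bondPercolation (zdGraph d) p).real (siteToBoundary d m) *
        (bondPercolation (zdGraph d) p).real (H ∩ siteToBoundary d j) := by
  classical
  have hγm0 : 0 ≤ (bondPercolation (zdGraph d) p).real (siteToBoundary d m) := measureReal_nonneg
  have hs0 : ∀ x, 0 ≤ ∑ C ∈ (box d j).powerset with x ∈ C,
      (bondPercolation (zdGraph d) p).real (clusterEvent (box d j) C ∩ H) :=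
    fun x => Finset.sum_nonneg fun C _ => measureReal_nonneg
  -- decomposition and termwise bound
  have h1 := real_siteToBoundary_inter_le_sum p (zero_mem_box d j) (subset_refl (box d j))
    (by omega : j < m + j + 1) H
  have h2 : ∑ x ∈ box d j, ∑ y ∈ (zdGraph d).neighborFinset x with y ∉ box d j,
      ∑ C ∈ (box d j).powerset with x ∈ C, (bondPercolation (zdGraph d) p).real
        ((clusterEvent (box d j) C ∩ H) ∩ {ω | s(x, y) ∈ ω} ∩ exitEvent (m + j + 1) C y) ≤
      ∑ x ∈ box d j, (#(((zdGraph d).neighborFinset x).filter (· ∉ box d j)) : ℝ) *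
        ((bondPercolation (zdGraph d) p).real (siteToBoundary d m) *
          ∑ C ∈ (box d j).powerset with x ∈ C,
            (bondPercolation (zdGraph d) p).real (clusterEvent (box d j) C ∩ H)) := by
    refine Finset.sum_le_sum fun x hx => ?_
    calc ∑ y ∈ (zdGraph d).neighborFinset x with y ∉ box d j,
          ∑ C ∈ (box d j).powerset with x ∈ C, (bondPercolation (zdGraph d) p).real
            ((clusterEvent (box d j) C ∩ H) ∩ {ω | s(x, y) ∈ ω} ∩ exitEvent (m + j + 1) C y)
        ≤ ∑ y ∈ (zdGraph d).neighborFinset x with y ∉ box d j,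
            ((bondPercolation (zdGraph d) p).real (siteToBoundary d m) *
              ∑ C ∈ (box d j).powerset with x ∈ C,
                (bondPercolation (zdGraph d) p).real (clusterEvent (box d j) C ∩ H)) := by
          refine Finset.sum_le_sum fun y hy => ?_
          rw [Finset.mem_filter, SimpleGraph.mem_neighborFinset] at hy
          rw [Finset.mul_sum]
          refine Finset.sum_le_sum fun C hC => ?_
          rw [Finset.mem_filter] at hC
          rw [mul_comm]
          exact real_term_le p (hdet C hC.1) hx hC.2 hy.2 hy.1
      _ = _ := by rw [Finset.sum_const, nsmul_eq_mul]
  -- the sums over `y` (at most `2d` terms, none unless `x ∈ ∂Λ_j`)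
  have h3 : ∑ x ∈ box d j, (#(((zdGraph d).neighborFinset x).filter (· ∉ box d j)) : ℝ) *
        ((bondPercolation (zdGraph d) p).real (siteToBoundary d m) *
          ∑ C ∈ (box d j).powerset with x ∈ C,
            (bondPercolation (zdGraph d) p).real (clusterEvent (box d j) C ∩ H)) ≤
      ∑ x ∈ sphere d j, 2 * d *
        ((bondPercolation (zdGraph d) p).real (siteToBoundary d m) *
          ∑ C ∈ (box d j).powerset with x ∈ C,
            (bondPercolation (zdGraph d) p).real (clusterEvent (box d j) C ∩ H)) := by
    rw [← Finset.sum_subset (sphere_subset_box d j)]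
    · refine Finset.sum_le_sum fun x _ => mul_le_mul_of_nonneg_right ?_ (mul_nonneg hγm0 (hs0 x))
      have h1 : #(((zdGraph d).neighborFinset x).filter (· ∉ box d j)) ≤ 2 * d :=
        (Finset.card_filter_le _ _).trans
          ((SimpleGraph.card_neighborFinset_eq_degree _ x).le.trans (degree_zdGraph_le x))
      exact_mod_cast h1
    · intro x hx hxs
      have : ((zdGraph d).neighborFinset x).filter (· ∉ box d j) = ∅ := by
        rw [Finset.filter_eq_empty_iff]
        intro y hy hyS
        rw [SimpleGraph.mem_neighborFinset] at hy
        exact hxs (mem_sphere_of_adj_not_mem_box hd hx hyS hy)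
      rw [this, Finset.card_empty, Nat.cast_zero, zero_mul]
  have h4 := sum_sphere_sum_real_clusterEvent_inter_le p hd j hT0 hdet hT
  calc (bondPercolation (zdGraph d) p).real (siteToBoundary d (m + j + 1) ∩ H)
      ≤ _ := h1
    _ ≤ _ := h2
    _ ≤ _ := h3
    _ = 2 * d * (bondPercolation (zdGraph d) p).real (siteToBoundary d m) *
          ∑ x ∈ sphere d j, ∑ C ∈ (box d j).powerset with x ∈ C,
            (bondPercolation (zdGraph d) p).real (clusterEvent (box d j) C ∩ H) := by
        rw [Finset.mul_sum]; exact Finset.sum_congr rfl fun x _ => by ring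
    _ ≤ 2 * d * (bondPercolation (zdGraph d) p).real (siteToBoundary d m) *
          (T * (bondPercolation (zdGraph d) p).real (H ∩ siteToBoundary d j)) :=
        mul_le_mul_of_nonneg_left h4 (by positivity)
    _ = _ := by ring

end OneBox

/-! ### Summing over the candidate boxes -/

section Sum

variable (p : unitInterval)

/-- **The regeneration bound, summed over `j`** (Kozma–Nachmias 2011, proof of Lemma 2.3, the term
`B₂`: `P(B₂) ≤ L² γ(λr/2) γ(r)`). Let `J` be a finite set of radii with `j₁ ≤ j` and `j + 1 + m₀ ≤ N`
for `j ∈ J`, and `H_j` (`j ∈ J`) pairwise disjoint measurable events (in the source `H_j = {j₀ = j}`)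
such that, on `{C(0;Q_j) = C}`, `H_j` is determined by the edges of `Q_j` touching `C` and forces
`|C ∩ ∂Q_j| ≤ T`. Then
`P({0 ↔ ∂Q_N} ∩ ⋃_{j ∈ J} H_j) ≤ 2d · T · P(0 ↔ ∂Q_{m₀}) · P(0 ↔ ∂Q_{j₁})`:
apply the one-box bound for each `j` (with `m = N - j - 1 ≥ m₀`), use the monotonicity of
`n ↦ P(0 ↔ ∂Q_n)` twice, and the disjointness of the `H_j` to resum
`Σ_j P(H_j ∩ {0 ↔ ∂Q_{j₁}}) ≤ P(0 ↔ ∂Q_{j₁})`.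
[cite: KozmaNachmias2011, proof of Lemma 2.3 (term B₂, pp. 382–383)] -/
theorem regeneration_bound (hd : 1 ≤ d) {J : Finset ℕ} {H : ℕ → Set (BondConfig (Site d))}
    {T : ℝ} (hT0 : 0 ≤ T) {N m₀ j₁ : ℕ} (hJ : ∀ j ∈ J, j₁ ≤ j ∧ j + 1 + m₀ ≤ N)
    (hmeas : ∀ j ∈ J, MeasurableSet (H j))
    (hdisj : ∀ j ∈ J, ∀ j' ∈ J, j ≠ j' → Disjoint (H j) (H j'))
    (hdet : ∀ j ∈ J, ∀ C ∈ (box d j).powerset,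
      DeterminedBy (clusterEvent (box d j) C ∩ H j) ↑(clusterPairs (box d j) C))
    (hT : ∀ j ∈ J, ∀ C ∈ (box d j).powerset, (clusterEvent (box d j) C ∩ H j).Nonempty →
      (#((sphere d j).filter (· ∈ C)) : ℝ) ≤ T) :
    (bondPercolation (zdGraph d) p).real (siteToBoundary d N ∩ ⋃ j ∈ J, H j) ≤
      2 * d * T * (bondPercolation (zdGraph d) p).real (siteToBoundary d m₀) *
        (bondPercolation (zdGraph d) p).real (siteToBoundary d j₁) := by
  set μ := bondPercolation (zdGraph d) p with hμ
  set γ : ℕ → ℝ := fun n => μ.real (siteToBoundary d n) with hγ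
  have hγ0 : ∀ n, 0 ≤ γ n := fun n => measureReal_nonneg
  -- each box
  have hbox : ∀ j ∈ J, μ.real (siteToBoundary d N ∩ H j) ≤
      2 * d * T * γ m₀ * μ.real (H j ∩ siteToBoundary d j₁) := by
    intro j hj
    obtain ⟨hj₁, hjN⟩ := hJ j hj
    obtain ⟨m, hm⟩ : ∃ m, N = m + j + 1 := ⟨N - j - 1, by omega⟩
    have hm₀ : m₀ ≤ m := by omega
    rw [hm]
    calc μ.real (siteToBoundary d (m + j + 1) ∩ H j)
        ≤ 2 * d * T * γ m * μ.real (H j ∩ siteToBoundary d j) :=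
          real_siteToBoundary_inter_le_of_box p hd j m hT0 (hdet j hj) (hT j hj)
      _ ≤ 2 * d * T * γ m₀ * μ.real (H j ∩ siteToBoundary d j₁) := by
          refine mul_le_mul (mul_le_mul_of_nonneg_left (real_siteToBoundary_antitone p hm₀)
            (by positivity)) ?_ measureReal_nonneg (by positivity)
          exact real_mono_of_forall_subset_edgeSet (zdGraph d) p fun ω hω h =>
            ⟨h.1, mem_siteToBoundary_of_le hω hj₁ h.2⟩
  -- resummation over `j`
  have hsum : ∑ j ∈ J, μ.real (H j ∩ siteToBoundary d j₁) ≤ γ j₁ := by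
    rw [← measureReal_biUnion_finset]
    · exact measureReal_mono (Set.iUnion₂_subset fun j _ => Set.inter_subset_right)
    · intro j hj j' hj' hjj'
      exact Disjoint.mono Set.inter_subset_left Set.inter_subset_left (hdisj j hj j' hj' hjj')
    · intro j hj
      exact (hmeas j hj).inter (measurableSet_siteToBoundary d j₁)
  calc μ.real (siteToBoundary d N ∩ ⋃ j ∈ J, H j)
      = μ.real (⋃ j ∈ J, (siteToBoundary d N ∩ H j)) := by rw [Set.inter_iUnion₂]
    _ ≤ ∑ j ∈ J, μ.real (siteToBoundary d N ∩ H j) := measureReal_biUnion_finset_le _ _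
    _ ≤ ∑ j ∈ J, 2 * d * T * γ m₀ * μ.real (H j ∩ siteToBoundary d j₁) := Finset.sum_le_sum hbox
    _ = 2 * d * T * γ m₀ * ∑ j ∈ J, μ.real (H j ∩ siteToBoundary d j₁) := by rw [Finset.mul_sum]
    _ ≤ 2 * d * T * γ m₀ * γ j₁ := mul_le_mul_of_nonneg_left hsum (by positivity)

end Sum

end Literature.Barriers.CriticalPhenomena

end
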